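import Summits.Ventures.LatticeQCDFlow.Scaling.LevelAutocorrelationFloor
import Summits.Ventures.LatticeQCDFlow.Scaling.ParallelTemperingTaggedReplica
import Summits.Ventures.LatticeQCDFlow.Scaling.CouplingOverlap
import Summits.Ventures.LatticeQCDFlow.Scaling.DefectSwapAcceptance

/-!
HONEST FRAMING: exact (Metropolis-corrected) sampling algorithms for lattice gauge theory; figures
of merit are autocorrelation/cost numbers at stated couplings and volumes; no continuum-physics
claim.

# ParallelTemperingDiffusive — REPLICA EXCHANGE (PARALLEL TEMPERING, PTBC) IS DIFFUSIVE: THE LEVEL OF A TAGGED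
# REPLICA HAS STATIONARY LAG-ONE AUTOCORRELATION `≥ 1 − 6ā_K/(K(K+2))`, `ā_K = (2/(K+1))·Σ_j swapAcc(β_j, β_{j+1})`,
# AND `≥ 1 − 48/(e·m·(b−a)²)` FOR EVERY NUMBER OF REPLICAS — EVERY WITHIN-REPLICA DYNAMICS, EVERY COMPACT GAUGE
# GROUP, AND THE BOUNDARY-CONDITION LADDER OF PTBC (lean-2 GEN-13, ours)

Venture-side (OURS).  Cell `lqcd-flow` (pub-lqcd), unit `pub-lqcd-lean-2-g13`, 2026-08-23.  GEN-11 priced the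
replica-exchange swap (`swapAcc ≤ exp(−m(t−s)²/4)` under a variance floor; `Ω((b−a)√m)` replicas NECESSARY,
for parallel tempering in the coupling and for PTBC's boundary-condition ladder); round trips stayed NOT CLAIMED.
This file is the tagged-replica analogue of `Scaling/SimulatedTemperingDiffusive`: the one-step movement bound of
`Scaling/LevelAutocorrelationFloor` applied to ANY Markov kernel `κ` on the tagged state space
`Fin (K+1) × (Fin (K+1) → Ω)` (`Scaling/ParallelTemperingTaggedReplica`) that (i) leaves the tagged target
`ptTaggedTarget X μ β K` (independent levels `μ_{β_k}`, uniform tag) invariant, (ii) moves the tag by at most one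
level per step, and (iii) moves it at all with probability at most `ptSwapRatio` (the Metropolis ratios of the
adjacent swaps containing the tag's level) — satisfied by one swap attempt, or one half-sweep of disjoint
adjacent swaps, with the exact product-target Metropolis test (`Exactness/PTBCSwap`: the swap is exact),
composed with any family of `μ_{β_k}`-preserving within-replica updates after it (or before it: same tag process
shifted by one step).

## What is proved (`μ` probability, `X` bounded measurable, `μ_u = μ.tilted(u·X)`, `swapAcc` of GEN-11)

* §1 **`pt_level_lagOneAutocorr_ge`** — under (i)–(iii), `K ≥ 1`, with `ρ_τ(1) = (E_π[τ₀τ₁] − (K/2)²)/(K(K+2)/12)`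
  the stationary lag-one autocorrelation of the tagged replica's level:
  `1 − 6ā_K/(K(K+2)) ≤ ρ_τ(1)`, `ā_K = (2/(K+1))·Σ_{j<K} swapAcc X μ β_j β_{j+1}`.
* §2 uniform ladder `β_k = a + k(b−a)/K`, `a < b`, floor `0 < m ≤ Var_{μ_u}(X)` on `[a,b]`: `pt_moveRate_le_ladder`
  (`ā_K ≤ (2K/(K+1))·exp(−m(b−a)²/(4K²))`) and THE REPLICA-NUMBER-FREE LAW **`pt_level_lagOneAutocorr_ge_kfree`**:
  `1 − 48/(e·m·(b−a)²) ≤ ρ_τ(1)` for EVERY `K ≥ 1`.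
* §3 **`wilson_pt_level_lagOneAutocorr_ge_allCouplings`** — the Wilson coupling ladder of every compact `G`
  (unitary continuous `ρ`, `d ≥ 2`, `L ≥ 2`, `Var_Haar(Re tr ρ) > 0`, `−B ≤ a < b ≤ B`):
  `1 − 48·exp(B·2NK'(1+4K'))/(e·⌊L/2⌋^d·Var_Haar(Re tr ρ)·(b−a)²) ≤ ρ_τ(1)`, `K' = (d+1)d²`.
* §4 **`defect_pt_level_lagOneAutocorr_ge`** — PTBC proper: the boundary-condition ladder of the defect family
  `μ_{β,u} ∝ e^{−βS_{Dᶜ}−uS_D}dU` (`Scaling/DefectSwapAcceptance`; every compact `G`, `Var_Haar(Re tr ρ) > 0`,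
  `L ≥ 2`, `#D ≥ 1`, `|β| ≤ B`, window `−B ≤ a < b ≤ B`): `1 − 48/(e·m_D·(b−a)²) ≤ ρ_τ(1)`,
  `m_D = e^{−8N(d−1)B}·(#D/(8d(d−1)+1))·Var_Haar(Re tr ρ)` — the tagged replica needs `Ω(#D·Δc²)` swap rounds to
  decorrelate its boundary condition, whatever the number of replicas and the within-replica algorithm.

Reading (no numerics implied): a replica of a parallel-tempering / PTBC run performs, in the ladder index, a
nearest-neighbour walk whose steps succeed with the adjacent swap acceptances; with exchangeable replicas its
level autocorrelation at lag one is within `6ā_K/(K(K+2))` of one, and optimising the number of replicas leaves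
`1 − ρ_τ(1) ≤ 48/(e·m·(b−a)²)`, `m` the smallest variance of the tempered energy on the window (extensive in the
volume for the coupling ladder, in `#D` for the boundary-condition ladder): `Ω(m·(b−a)²)` swap rounds per
decorrelation of a replica's level, hence per round trip.  NOT CLAIMED: a construction of the tagged swap kernel
(the laws quantify over all kernels with (i)–(iii)); full sequential swap sweeps as one step (the tag may then
move several levels — take half-sweeps or single attempts as the step); non-uniform ladders in the `K`-free form;
`τ_int`, round-trip times as stopping times, spectral gaps; any measured number (the printed PTBC runs included).
Literature grade (cell rule): KNOWN MECHANISM (diffusive replica motion and `√C_V` spacing —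
Katzgraber–Trebst–Huse–Troyer, J. Stat. Mech. (2006) P03018; torpid mixing of parallel tempering via adjacent
overlaps — Woodard–Schmidler–Huber, Electron. J. Probab. 14 (2009) 780), NEW TYPING (kernel level, tagged
replica, replica-number-free constant, every compact gauge group, the PTBC defect ladder); nothing cited as a fact.
-/

noncomputable section

open MeasureTheory ProbabilityTheory Set Filter Finset
open Literature.MathematicalPhysics.QuantumFieldTheory
open Literature.MathematicalPhysics.QuantumFieldTheory.Luscher2010
open Summit.Ventures.LatticeQCDFlow.Scoring
open Summit.Ventures.LatticeQCDFlow.TrivializingMaps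
open scoped ENNReal

namespace Summit.Ventures.LatticeQCDFlow.Scaling

/-! ## §1 The tagged replica's level law -/

section Law

variable {Ω : Type*} [MeasurableSpace Ω] {X : Ω → ℝ} {μ : Measure Ω} [IsProbabilityMeasure μ]
  {β : ℕ → ℝ} {K : ℕ}

/-- **THE LEVEL AUTOCORRELATION LAW OF A TAGGED REPLICA** (`μ` probability, `X` bounded measurable, levels
`β_0, …, β_K`, `K ≥ 1`).  Let `κ` be ANY Markov kernel on `Fin (K+1) × (Fin (K+1) → Ω)` that (i) leaves the tagged
target `ptTaggedTarget X μ β K` invariant, (ii) moves the tag by at most one level per step (`κ(z,·)`-a.e.), and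
(iii) moves it at all with probability at most `ptSwapRatio X β K z` (the Metropolis ratios of the adjacent swaps
containing the tag's level).  Then `1 − 6ā_K/(K(K+2)) ≤ ρ_τ(1)`, `ā_K = (2/(K+1))·Σ_{j<K} swapAcc X μ β_j β_{j+1}`. [ours] -/
theorem pt_level_lagOneAutocorr_ge (hXm : Measurable X) (hXb : ∃ C, ∀ x, |X x| ≤ C) (hK : 1 ≤ K)
    (κ : Kernel (Fin (K + 1) × (Fin (K + 1) → Ω)) (Fin (K + 1) × (Fin (K + 1) → Ω))) [IsMarkovKernel κ]
    (hinv : Kernel.Invariant κ (ptTaggedTarget X μ β K))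
    (hnn : ∀ z, ∀ᵐ y ∂(κ z), |(((y.1 : Fin (K + 1)) : ℕ) : ℝ) - ((z.1 : Fin (K + 1)) : ℕ)| ≤ 1)
    (hmove : ∀ z, (κ z).real {y | ((y.1 : Fin (K + 1)) : ℕ) ≠ ((z.1 : Fin (K + 1)) : ℕ)} ≤ ptSwapRatio X β K z) :
    1 - 6 * (2 / (K + 1) * ∑ j : Fin K, swapAcc X μ (β (j : ℕ)) (β ((j : ℕ) + 1))) / (K * (K + 2)) ≤
      (autocov κ (ptTaggedTarget X μ β K) (fun z => (((z.1 : Fin (K + 1)) : ℕ) : ℝ)) 1 - ((K : ℝ) / 2) ^ 2) /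
        (K * (K + 2) / 12) := by
  haveI := isProbabilityMeasure_ptTaggedTarget (μ := μ) (β := β) (K := K) hXm hXb
  have h := level_lagOneAutocorr_ge (lev := fun z : Fin (K + 1) × (Fin (K + 1) → Ω) => ((z.1 : Fin (K + 1)) : ℕ))
    hinv measurable_ptLevel (fun z => Nat.le_of_lt_succ z.1.isLt) hK
    (fun k hk => ptTaggedTarget_real_level hXm hXb k hk) hnn (measurable_ptSwapRatio hXm) (R := 2 * K)
    ptSwapRatio_nonneg ptSwapRatio_le hmove
  rwa [pt_moveRate_eq hXm hXb] at h

end Law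

/-! ## §2 Uniform ladders under a variance floor: the replica-number-free law -/

section Ladder

variable {Ω : Type*} [MeasurableSpace Ω] {X : Ω → ℝ} {μ : Measure Ω} [IsProbabilityMeasure μ] {K : ℕ}

/-- **Adjacent swap acceptances on a uniform ladder under a variance floor**: `β_k = a + k(b−a)/K`, `a ≤ b`,
`K ≥ 1`, `m ≤ Var_{μ_u}(X)` on `[a,b]` ⇒ `ā_K ≤ (2K/(K+1))·exp(−m(b−a)²/(4K²))` (GEN-11's
`swapAcc_le_exp_neg_floor`). [ours] -/
theorem pt_moveRate_le_ladder (hXm : Measurable X) (hXb : ∃ C, ∀ x, |X x| ≤ C) {a b m : ℝ} (hab : a ≤ b)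
    (hK : 1 ≤ K) (hm : ∀ u ∈ Icc a b, m ≤ variance X (μ.tilted fun x => u * X x)) :
    2 / (K + 1) * ∑ j : Fin K, swapAcc X μ (a + (j : ℕ) * ((b - a) / K)) (a + (((j : ℕ) + 1 : ℕ) : ℝ) * ((b - a) / K)) ≤
      2 * K / (K + 1) * Real.exp (-(m * (b - a) ^ 2 / (4 * K ^ 2))) := by
  have hKr : (1 : ℝ) ≤ K := by exact_mod_cast hK
  have hK0 : (0 : ℝ) < K := by linarith
  have hδ : 0 ≤ (b - a) / K := div_nonneg (sub_nonneg.2 hab) hK0.le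
  have hstep : ∀ j : Fin K, swapAcc X μ (a + (j : ℕ) * ((b - a) / K)) (a + (((j : ℕ) + 1 : ℕ) : ℝ) * ((b - a) / K)) ≤
      Real.exp (-(m * (b - a) ^ 2 / (4 * K ^ 2))) := by
    intro j
    have hjK : ((j : ℕ) : ℝ) + 1 ≤ K := by exact_mod_cast Nat.succ_le_of_lt j.isLt
    have hs : a ≤ a + (j : ℕ) * ((b - a) / K) := le_add_of_nonneg_right (mul_nonneg (Nat.cast_nonneg _) hδ)
    have hst : a + (j : ℕ) * ((b - a) / K) ≤ a + (((j : ℕ) + 1 : ℕ) : ℝ) * ((b - a) / K) := by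
      push_cast; nlinarith
    have ht : a + (((j : ℕ) + 1 : ℕ) : ℝ) * ((b - a) / K) ≤ b := by
      push_cast
      have : (((j : ℕ) : ℝ) + 1) * ((b - a) / K) ≤ K * ((b - a) / K) := mul_le_mul_of_nonneg_right hjK hδ
      rw [mul_div_cancel₀ _ hK0.ne'] at this
      linarith
    refine (swapAcc_le_exp_neg_floor hXm hXb hst fun u hu => hm u ⟨hs.trans hu.1, hu.2.trans ht⟩).trans ?_
    apply Real.exp_le_exp.2
    have e : a + (((j : ℕ) + 1 : ℕ) : ℝ) * ((b - a) / K) - (a + (j : ℕ) * ((b - a) / K)) = (b - a) / K := by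
      push_cast; ring
    rw [e, div_pow]
    apply neg_le_neg
    apply le_of_eq
    field_simp
  calc 2 / (K + 1) * ∑ j : Fin K, swapAcc X μ (a + (j : ℕ) * ((b - a) / K)) (a + (((j : ℕ) + 1 : ℕ) : ℝ) * ((b - a) / K))
      ≤ 2 / (K + 1) * ∑ _j : Fin K, Real.exp (-(m * (b - a) ^ 2 / (4 * K ^ 2))) := by
        gcongr with j _
        exact hstep j
    _ = 2 * K / (K + 1) * Real.exp (-(m * (b - a) ^ 2 / (4 * K ^ 2))) := by
        rw [Finset.sum_const, Finset.card_univ, Fintype.card_fin, nsmul_eq_mul]; ring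

/-- **THE REPLICA-NUMBER-FREE LAW.**  Uniform ladder `β_k = a + k(b−a)/K` from `a` to `b > a`, `K ≥ 1`, variance
floor `0 < m ≤ Var_{μ_u}(X)` on `[a, b]`; `κ` any Markov kernel on the tagged space satisfying (i)–(iii) of
`pt_level_lagOneAutocorr_ge` for this ladder.  Then, WHATEVER `K`, `1 − 48/(e·m·(b−a)²) ≤ ρ_τ(1)`. [ours] -/
theorem pt_level_lagOneAutocorr_ge_kfree (hXm : Measurable X) (hXb : ∃ C, ∀ x, |X x| ≤ C) {a b m : ℝ}
    (hab : a < b) (hm0 : 0 < m) (hm : ∀ u ∈ Icc a b, m ≤ variance X (μ.tilted fun x => u * X x))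
    (hK : 1 ≤ K) (κ : Kernel (Fin (K + 1) × (Fin (K + 1) → Ω)) (Fin (K + 1) × (Fin (K + 1) → Ω)))
    [IsMarkovKernel κ]
    (hinv : Kernel.Invariant κ (ptTaggedTarget X μ (fun k => a + k * ((b - a) / K)) K))
    (hnn : ∀ z, ∀ᵐ y ∂(κ z), |(((y.1 : Fin (K + 1)) : ℕ) : ℝ) - ((z.1 : Fin (K + 1)) : ℕ)| ≤ 1)
    (hmove : ∀ z, (κ z).real {y | ((y.1 : Fin (K + 1)) : ℕ) ≠ ((z.1 : Fin (K + 1)) : ℕ)} ≤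
      ptSwapRatio X (fun k => a + k * ((b - a) / K)) K z) :
    1 - 48 / (Real.exp 1 * m * (b - a) ^ 2) ≤
      (autocov κ (ptTaggedTarget X μ (fun k => a + k * ((b - a) / K)) K)
          (fun z => (((z.1 : Fin (K + 1)) : ℕ) : ℝ)) 1 - ((K : ℝ) / 2) ^ 2) / (K * (K + 2) / 12) := by
  have h := pt_level_lagOneAutocorr_ge (β := fun k => a + k * ((b - a) / K)) hXm hXb hK κ hinv hnn hmove
  refine le_trans ?_ h
  have hrate := pt_moveRate_le_ladder (μ := μ) hXm hXb hab.le hK hm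
  have hKr : (1 : ℝ) ≤ K := by exact_mod_cast hK
  have hKpos : (0 : ℝ) < K * (K + 2) := by positivity
  have hA : 0 < m * (b - a) ^ 2 / 4 := by
    have : 0 < (b - a) ^ 2 := by nlinarith
    positivity
  have hkfree := ladder_rate_kfree hA hKr
  have e1 : -(m * (b - a) ^ 2 / 4 / (K : ℝ) ^ 2) = -(m * (b - a) ^ 2 / (4 * K ^ 2)) := by rw [div_div]
  rw [e1] at hkfree
  have e2 : 12 / (Real.exp 1 * (m * (b - a) ^ 2 / 4)) = 48 / (Real.exp 1 * m * (b - a) ^ 2) := by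
    field_simp
    ring
  rw [e2] at hkfree
  have hsum : (∑ j : Fin K, swapAcc X μ ((fun k : ℕ => a + k * ((b - a) / K)) (j : ℕ))
      ((fun k : ℕ => a + k * ((b - a) / K)) ((j : ℕ) + 1))) =
      ∑ j : Fin K, swapAcc X μ (a + (j : ℕ) * ((b - a) / K)) (a + (((j : ℕ) + 1 : ℕ) : ℝ) * ((b - a) / K)) := by
    refine Finset.sum_congr rfl fun j _ => ?_
    simp only [Nat.cast_add, Nat.cast_one]
  have hchain : 6 * (2 / (K + 1) * ∑ j : Fin K, swapAcc X μ ((fun k : ℕ => a + k * ((b - a) / K)) (j : ℕ))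
      ((fun k : ℕ => a + k * ((b - a) / K)) ((j : ℕ) + 1))) / (K * (K + 2)) ≤
      12 * Real.exp (-(m * (b - a) ^ 2 / (4 * K ^ 2))) / ((K + 1) * (K + 2)) := by
    rw [hsum]
    calc 6 * (2 / (K + 1) * ∑ j : Fin K, swapAcc X μ (a + (j : ℕ) * ((b - a) / K))
          (a + (((j : ℕ) + 1 : ℕ) : ℝ) * ((b - a) / K))) / (K * (K + 2))
        ≤ 6 * (2 * K / (K + 1) * Real.exp (-(m * (b - a) ^ 2 / (4 * K ^ 2)))) / (K * (K + 2)) := by gcongr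
      _ = 12 * Real.exp (-(m * (b - a) ^ 2 / (4 * K ^ 2))) / ((K + 1) * (K + 2)) := by
          field_simp
          ring
  linarith [hchain, hkfree]

end Ladder

/-! ## §3 The Wilson coupling ladder, every compact gauge group, every coupling -/

section Wilson

variable {d L N : ℕ} [NeZero L] {G : Type*} [Group G] [TopologicalSpace G] [IsTopologicalGroup G]
  [CompactSpace G] [MeasurableSpace G] [BorelSpace G] [SecondCountableTopology G]
  (ρ : G →* Matrix (Fin N) (Fin N) ℂ)

/-- **PARALLEL TEMPERING IN THE WILSON COUPLING IS DIFFUSIVE AT EVERY COUPLING, FOR EVERY COMPACT GAUGE GROUP**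
(unitary continuous `ρ`, `d ≥ 2`, `L ≥ 2`, `Var_Haar(Re tr ρ) > 0`, `−B ≤ a < b ≤ B`, `K ≥ 1`; `X = −S_W` over `D[U]`).
For EVERY Markov kernel on the tagged space leaving the tagged target over the uniform ladder from `a` to `b`
invariant, moving the tag by at most one level with probability at most the adjacent swap ratios:
`1 − 48·exp(B·2NK'(1+4K'))/(e·⌊L/2⌋^d·Var_Haar(Re tr ρ)·(b−a)²) ≤ ρ_τ(1)`, `K' = (d+1)d²`. [ours] -/
theorem wilson_pt_level_lagOneAutocorr_ge_allCouplings (hd : 2 ≤ d) (hL : 2 ≤ L) (hρ : Continuous ρ)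
    (hρu : ∀ g, ρ g ∈ Matrix.unitaryGroup (Fin N) ℂ)
    (hv : 0 < variance (fun g => (ρ g).trace.re) (haarProbability G)) {a b B : ℝ} (ha : -B ≤ a)
    (hab : a < b) (hb : b ≤ B) {K : ℕ} (hK : 1 ≤ K)
    (κ : Kernel (Fin (K + 1) × (Fin (K + 1) → GaugeConfig d L G)) (Fin (K + 1) × (Fin (K + 1) → GaugeConfig d L G)))
    [IsMarkovKernel κ]
    (hinv : Kernel.Invariant κ (ptTaggedTarget (fun U => -wilsonAction ρ U) (trivialMeasure G d L)
      (fun k => a + k * ((b - a) / K)) K))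
    (hnn : ∀ z, ∀ᵐ y ∂(κ z), |(((y.1 : Fin (K + 1)) : ℕ) : ℝ) - ((z.1 : Fin (K + 1)) : ℕ)| ≤ 1)
    (hmove : ∀ z, (κ z).real {y | ((y.1 : Fin (K + 1)) : ℕ) ≠ ((z.1 : Fin (K + 1)) : ℕ)} ≤
      ptSwapRatio (fun U => -wilsonAction ρ U) (fun k => a + k * ((b - a) / K)) K z) :
    1 - 48 * Real.exp (B * (2 * N * ((d + 1) * d ^ 2 : ℕ) * (1 + 4 * ((d + 1) * d ^ 2 : ℕ)))) /
        (Real.exp 1 * (((L / 2) ^ d : ℕ) * variance (fun g => (ρ g).trace.re) (haarProbability G)) *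
          (b - a) ^ 2) ≤
      (autocov κ (ptTaggedTarget (fun U => -wilsonAction ρ U) (trivialMeasure G d L)
            (fun k => a + k * ((b - a) / K)) K)
          (fun z => (((z.1 : Fin (K + 1)) : ℕ) : ℝ)) 1 - ((K : ℝ) / 2) ^ 2) / (K * (K + 2) / 12) := by
  haveI : IsProbabilityMeasure (trivialMeasure G d L) := trivialMeasure_isProbabilityMeasure
  set m : ℝ := Real.exp (-(B * (2 * N * ((d + 1) * d ^ 2 : ℕ) * (1 + 4 * ((d + 1) * d ^ 2 : ℕ))))) *
    ((L / 2) ^ d : ℕ) * variance (fun g => (ρ g).trace.re) (haarProbability G) with hm_def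
  have hLd : 0 < ((L / 2) ^ d : ℕ) := by
    have : 1 ≤ L / 2 := Nat.le_div_iff_mul_le (by norm_num) |>.2 (by omega)
    exact pow_pos (by omega) d
  have hm0 : 0 < m := by
    rw [hm_def]
    refine mul_pos (mul_pos (Real.exp_pos _) ?_) hv
    exact_mod_cast hLd
  have hfloor : ∀ u ∈ Icc a b, m ≤ variance (fun U => -wilsonAction ρ U)
      ((trivialMeasure G d L).tilted fun U => u * (-wilsonAction ρ U)) := by
    intro u hu
    rw [tilted_neg_wilsonAction_eq ρ hρ u, variance_fun_neg]
    refine le_trans ?_ (wilson_variance_ge_allCouplings (d := d) (L := L) ρ hd hL hρ hρu u)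
    have hvn : 0 ≤ variance (fun g => (ρ g).trace.re) (haarProbability G) := variance_nonneg _ _
    have hu' : |u| ≤ B := abs_le.2 ⟨by linarith [hu.1], by linarith [hu.2]⟩
    have hc : 0 ≤ (2 * N * ((d + 1) * d ^ 2 : ℕ) * (1 + 4 * ((d + 1) * d ^ 2 : ℕ)) : ℝ) := by positivity
    rw [hm_def]
    gcongr
  have h := pt_level_lagOneAutocorr_ge_kfree (μ := trivialMeasure G d L) (measurable_neg_wilsonAction ρ hρ)
    (neg_wilsonAction_bounded ρ hρ) hab hm0 hfloor hK κ hinv hnn hmove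
  refine le_trans (le_of_eq ?_) h
  rw [hm_def, Real.exp_neg]
  field_simp

end Wilson

/-! ## §4 PTBC: the boundary-condition ladder of the defect family -/

section Defect

variable {d L N : ℕ} [NeZero L] {G : Type*} [Group G] [TopologicalSpace G] [IsTopologicalGroup G]
  [CompactSpace G] [MeasurableSpace G] [BorelSpace G] [SecondCountableTopology G]
  (ρ : G →* Matrix (Fin N) (Fin N) ℂ)

/-- **PTBC IS DIFFUSIVE IN THE DEFECT SIZE** (every compact `G`, continuous `ρ` with `Var_Haar(Re tr ρ) > 0`,
`L ≥ 2`, a non-empty finite plaquette set `D`, bulk coupling `|β| ≤ B`, boundary-condition window `−B ≤ a < b ≤ B`,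
`K ≥ 1`).  For the defect family `μ_{β,u} ∝ e^{−βS_{Dᶜ}−uS_D}dU` (Hasenbusch 2017; Bonanno–Bonati–D'Elia 2021) and
EVERY Markov kernel on the tagged replica space leaving the tagged target over the uniform boundary-condition ladder
from `a` to `b` invariant, moving the tag by at most one level with probability at most the adjacent swap ratios:
`1 − 48/(e·m_D·(b−a)²) ≤ ρ_τ(1)`, `m_D = e^{−8N(d−1)B}·(#D/(8d(d−1)+1))·Var_Haar(Re tr ρ)` (lean-1's defect
specific-heat floor) — `Ω(#D·(b−a)²)` swap rounds per decorrelation of a replica's boundary condition, for every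
number of replicas and every within-replica algorithm. [ours] -/
theorem defect_pt_level_lagOneAutocorr_ge (hL : 2 ≤ L) (hρ : Continuous ρ)
    (hv : 0 < variance (fun g : G => (ρ g).trace.re) (haarProbability G)) (D : Finset (Plaquette d L))
    (hD : 0 < D.card) {β B a b : ℝ} (hβ : |β| ≤ B) (ha : -B ≤ a) (hab : a < b) (hb : b ≤ B)
    {K : ℕ} (hK : 1 ≤ K)
    (κ : Kernel (Fin (K + 1) × (Fin (K + 1) → GaugeConfig d L G)) (Fin (K + 1) × (Fin (K + 1) → GaugeConfig d L G)))
    [IsMarkovKernel κ]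
    (hinv : Kernel.Invariant κ (ptTaggedTarget
      (fun U : GaugeConfig d L G => -(∑ p ∈ D, ((N : ℝ) - (ρ (plaquetteHolonomy U p.1 p.2.1.1 p.2.1.2)).trace.re)))
      ((Measure.pi fun _ : Edge d L => haarProbability G).tilted fun U =>
        -(β * ∑ p ∈ Dᶜ, ((N : ℝ) - (ρ (plaquetteHolonomy U p.1 p.2.1.1 p.2.1.2)).trace.re)))
      (fun k => a + k * ((b - a) / K)) K))
    (hnn : ∀ z, ∀ᵐ y ∂(κ z), |(((y.1 : Fin (K + 1)) : ℕ) : ℝ) - ((z.1 : Fin (K + 1)) : ℕ)| ≤ 1)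
    (hmove : ∀ z, (κ z).real {y | ((y.1 : Fin (K + 1)) : ℕ) ≠ ((z.1 : Fin (K + 1)) : ℕ)} ≤
      ptSwapRatio
        (fun U : GaugeConfig d L G => -(∑ p ∈ D, ((N : ℝ) - (ρ (plaquetteHolonomy U p.1 p.2.1.1 p.2.1.2)).trace.re)))
        (fun k => a + k * ((b - a) / K)) K z) :
    1 - 48 / (Real.exp 1 * (Real.exp (-(8 * N * ((d - 1 : ℕ) : ℝ) * B)) *
        ((D.card : ℝ) / ((8 * d * (d - 1) + 1 : ℕ) : ℝ)) *
          variance (fun g : G => (ρ g).trace.re) (haarProbability G)) * (b - a) ^ 2) ≤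
      (autocov κ (ptTaggedTarget
            (fun U : GaugeConfig d L G =>
              -(∑ p ∈ D, ((N : ℝ) - (ρ (plaquetteHolonomy U p.1 p.2.1.1 p.2.1.2)).trace.re)))
            ((Measure.pi fun _ : Edge d L => haarProbability G).tilted fun U =>
              -(β * ∑ p ∈ Dᶜ, ((N : ℝ) - (ρ (plaquetteHolonomy U p.1 p.2.1.1 p.2.1.2)).trace.re)))
            (fun k => a + k * ((b - a) / K)) K)
          (fun z => (((z.1 : Fin (K + 1)) : ℕ) : ℝ)) 1 - ((K : ℝ) / 2) ^ 2) / (K * (K + 2) / 12) := by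
  haveI := isProbabilityMeasure_defectBase (d := d) (L := L) ρ hρ β D
  have hm0 : 0 < Real.exp (-(8 * N * ((d - 1 : ℕ) : ℝ) * B)) *
      ((D.card : ℝ) / ((8 * d * (d - 1) + 1 : ℕ) : ℝ)) * variance (fun g : G => (ρ g).trace.re) (haarProbability G) := by
    have hDr : (0 : ℝ) < D.card := by exact_mod_cast hD
    have hden : (0 : ℝ) < ((8 * d * (d - 1) + 1 : ℕ) : ℝ) := by positivity
    exact mul_pos (mul_pos (Real.exp_pos _) (div_pos hDr hden)) hv
  have hfloor : ∀ u ∈ Icc a b, Real.exp (-(8 * N * ((d - 1 : ℕ) : ℝ) * B)) *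
      ((D.card : ℝ) / ((8 * d * (d - 1) + 1 : ℕ) : ℝ)) * variance (fun g : G => (ρ g).trace.re) (haarProbability G) ≤
      variance (fun U : GaugeConfig d L G =>
          -(∑ p ∈ D, ((N : ℝ) - (ρ (plaquetteHolonomy U p.1 p.2.1.1 p.2.1.2)).trace.re)))
        ((((Measure.pi fun _ : Edge d L => haarProbability G).tilted fun U =>
          -(β * ∑ p ∈ Dᶜ, ((N : ℝ) - (ρ (plaquetteHolonomy U p.1 p.2.1.1 p.2.1.2)).trace.re))).tilted
          fun U => u * (-(∑ p ∈ D, ((N : ℝ) - (ρ (plaquetteHolonomy U p.1 p.2.1.1 p.2.1.2)).trace.re))))) :=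
    fun u hu => defect_floor_family (d := d) (L := L) ρ hL hρ hβ
      (abs_le.2 ⟨by linarith [hu.1], by linarith [hu.2]⟩) D
  exact pt_level_lagOneAutocorr_ge_kfree (measurable_neg_defectSum ρ hρ D) (neg_defectSum_bounded ρ hρ D)
    hab hm0 hfloor hK κ hinv hnn hmove

end Defect

end Summit.Ventures.LatticeQCDFlow.Scaling

end
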